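import Mathlib
import Literature.Analysis.FluidPDE.ClassicalSolution
import Literature.Analysis.FluidPDE.LerayHopf
import Literature.Analysis.FluidPDE.NSWave0
import Summits.NavierStokesRegularity.NavierStokesRegularity.Theses.L3TimeExponentPincer
import Summits.NavierStokesRegularity.NavierStokesRegularity.Theorems.L3TimeExponentPincerSmoothBranch
import Summits.NavierStokesRegularity.NavierStokesRegularity.Theorems.L3TimeExponentPincerNoBlowupToClay
import Summits.NavierStokesRegularity.NavierStokesRegularity.Theorems.L3TimeExponentPincerAssembly
import Summits.NavierStokesRegularity.NavierStokesRegularity.Theorems.HodographBetchovEquivalence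
import Summits.NavierStokesRegularity.NavierStokesRegularity.Theorems.SoloInformedClayDichotomy
import Summits.NavierStokesRegularity.NavierStokesRegularity.Theorems.NavierStokesBreakdownR3
import HarnessLib

/-!
# Route `L3TimeExponentPincer` is an equivalent reformulation of Clay (A); its three cruxes are
# ON PATH (each is implied by the summit), and refuting any of them proves Clay (C)

Support file for the PARENT crux `L3CascadeJaw` (stmt-NavierStokesRegularity-19499) of route
`L3TimeExponentPincer` (cell ns-regularity-ideate, seat ns-pincer-19499-p1); it serves the child crux
`EffSatBlowup` (19139) and the residual `SupercriticalSerrinL3` (19500) equally.  Every hypothesis of the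
route's deciding theorem `Theses.L3TimeExponentPincer.closes` is here placed logically against the summit
`NavierStokesRegularity` (Clay (A)) by tree theorems — none closes an item:

* `noBlowup_frame_of_navierStokesRegularity` — Clay (A) ⇒ no frame blow-up (every classical solution on
  `[0,T)` that is Leray–Hopf from a rapidly decaying datum extends smoothly past `T`): the tree's
  `HodographBetchov.noBlowup_of_navierStokesRegularity` (Tao 2013 Cor. 11.4 uniqueness `X5b` +
  `blowup_assembly`), re-exported in the route's frame;
* **NECESSITY** — `l3CascadeJaw_of_noBlowup` / `l3CascadeJaw_of_navierStokesRegularity` (the parent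
  crux is implied by the summit: under (A) every frame solution is on the smooth branch, where the jaw is
  the theorem `jawSmoothBranch_holds`), `effSatBlowup_of_navierStokesRegularity` (the child crux, which
  quantifies over blow-ups only, holds vacuously), `supercriticalSerrinL3_of_navierStokesRegularity` (the
  residual: its conclusion is no-blow-up itself);
* **EQUIVALENCE** — `navierStokesRegularity_iff_pincer : NavierStokesRegularity ↔
  L3CascadeJaw ∧ SupercriticalSerrinL3` (sufficiency is the landed assembly
  `l3TimeExponentPincer_assembly_proof` with `noBlowupToClay_item`); given either crux the other is
  equivalent to the summit (`l3CascadeJaw_iff_navierStokesRegularity`,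
  `supercriticalSerrinL3_iff_navierStokesRegularity`); and the split:
  `navierStokesRegularity_iff_effSat_and_residual`;
* **KILL VALUE** — `navierStokesBreakdownR3_of_not_l3CascadeJaw` (and `…_of_not_effSatBlowup`,
  `…_of_not_supercriticalSerrinL3`): a refutation of ANY of the three cruxes refutes Clay (A) and hence,
  by the landed dichotomy `navierStokesRegularity_or_breakdownR3`, PROVES Fefferman's breakdown statement
  (C) (the summit-side conjecture leaf `Summit.….NavierStokesBreakdownR3`, definitionally the Literature
  statement `Literature.Analysis.FluidPDE.NavierStokesBreakdownR3` the dichotomy is typed with) — a refuting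
  seat on this route is summit-bearing on the negative side (board rule D-0052).

Reading for the tribunal (T1 strength / BC records): the route is LOSSLESS at the level of its cruxes
(no over-attack in `L3CascadeJaw` or `SupercriticalSerrinL3` relative to (A): both are consequences of
(A)); what each crux ADDS is a split of (A) into an a-priori `L^q_t L³_x` estimate (`4 < q < 5`) and a
supercritical Serrin criterion, whose conjunction is exactly (A).

WHAT THIS IS NOT: not a claim about Navier–Stokes regularity or blow-up; pure logical placement of the
route's items against the summit, landed `--supports … --as helper`.
-/

noncomputable section

namespace Summit.NavierStokesRegularity.NavierStokesRegularity.Theorems.L3TimeExponentPincerRouteEquivalence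

open MeasureTheory Set Function Filter Topology
open scoped ENNReal NNReal
open Literature.Analysis.FluidPDE
open Summit.NavierStokesRegularity.NavierStokesRegularity.Theses.L3TimeExponentPincer
  (L3CascadeJaw EffSatBlowup SupercriticalSerrinL3 NoBlowupToClay)
open Summit.NavierStokesRegularity.NavierStokesRegularity.Theorems.L3TimeExponentPincerSmoothBranch
  (jawSmoothBranch_holds)
open Summit.NavierStokesRegularity.NavierStokesRegularity.Theorems.L3TimeExponentPincerNoBlowupToClay
  (noBlowupToClay_item)

/-! ## Clay (A) ⇒ no frame blow-up -/

/-- **Clay (A) ⇒ no blow-up in the route's frame**: if `NavierStokesRegularity` holds then every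
classical solution of the unforced system on `ℝ³ × [0,T)`, `ν, T > 0`, that is Leray–Hopf from its
rapidly decaying datum extends smoothly past `T` (the tree's
`HodographBetchov.noBlowup_of_navierStokesRegularity`: Clay-class uniqueness `X5b`, Tao 2013 Cor. 11.4,
run through `blowup_assembly`). [cite: Tao2011, Cor. 11.4] -/
theorem noBlowup_frame_of_navierStokesRegularity (hA : _root_.NavierStokesRegularity) {ν T : ℝ}
    (hν : 0 < ν) (hT : 0 < T)
    {u : ℝ → EuclideanSpace ℝ (Fin 3) → EuclideanSpace ℝ (Fin 3)} {p : ℝ → EuclideanSpace ℝ (Fin 3) → ℝ}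
    (hcl : IsClassicalNSSolutionOn (Ico 0 T) ν 0 u p) (hLH : IsLerayHopfOn T ν 0 (u 0) u)
    (hdec : HasRapidSpatialDecay (u 0)) : HasSmoothExtensionPast ν 0 u T :=
  HodographBetchov.noBlowup_of_navierStokesRegularity hA ν T hν hT u p hcl hLH hdec

/-! ## Necessity: the three cruxes are consequences of the summit -/

/-- **No blow-up ⇒ `L3CascadeJaw`.** If every frame solution extends smoothly past its `T`, the jaw
holds for every `q ∈ (4,5)`: on the smooth branch `‖u(t)‖₃` is bounded near `T`
(`jawSmoothBranch_holds`, item 19140). [folklore] -/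
theorem l3CascadeJaw_of_noBlowup
    (hNB : ∀ (ν T : ℝ), 0 < ν → 0 < T →
      ∀ (u : ℝ → EuclideanSpace ℝ (Fin 3) → EuclideanSpace ℝ (Fin 3)) (p : ℝ → EuclideanSpace ℝ (Fin 3) → ℝ),
        IsClassicalNSSolutionOn (Ico 0 T) ν 0 u p → IsLerayHopfOn T ν 0 (u 0) u →
        HasRapidSpatialDecay (u 0) → HasSmoothExtensionPast ν 0 u T) :
    L3CascadeJaw :=
  fun q hq4 hq5 ν T hν hT u p hcl hLH hdec =>
    jawSmoothBranch_holds q hq4 hq5 ν T hν hT u p hcl hLH hdec (hNB ν T hν hT u p hcl hLH hdec)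

/-- **NECESSITY of the parent crux: `NavierStokesRegularity → L3CascadeJaw`.**  The attacked conjunct
of the route is implied by the summit it attacks (Clay (A) ⇒ no frame blow-up ⇒ smooth branch ⇒ jaw);
in particular `L3CascadeJaw` cannot be refuted without refuting Clay (A). [folklore] -/
theorem l3CascadeJaw_of_navierStokesRegularity (hA : _root_.NavierStokesRegularity) : L3CascadeJaw :=
  l3CascadeJaw_of_noBlowup fun _ _ hν hT _ _ hcl hLH hdec =>
    noBlowup_frame_of_navierStokesRegularity hA hν hT hcl hLH hdec

/-- **NECESSITY of the child crux: `NavierStokesRegularity → EffSatBlowup`** (stmt 19139 quantifies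
over frame solutions WITHOUT smooth extension; under (A) there are none). [folklore] -/
theorem effSatBlowup_of_navierStokesRegularity (hA : _root_.NavierStokesRegularity) : EffSatBlowup :=
  fun _ _ hν hT _ _ hcl hLH hdec hmax =>
    absurd (noBlowup_frame_of_navierStokesRegularity hA hν hT hcl hLH hdec) hmax

/-- **NECESSITY of the residual: `NavierStokesRegularity → SupercriticalSerrinL3`** (its conclusion
is smooth extension past `T`, which (A) gives outright; witness exponent `q = 9/2`). [folklore] -/
theorem supercriticalSerrinL3_of_navierStokesRegularity (hA : _root_.NavierStokesRegularity) :
    SupercriticalSerrinL3 :=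
  ⟨9 / 2, by norm_num, by norm_num, fun _ _ hν hT _ _ hcl hLH hdec _ =>
    noBlowup_frame_of_navierStokesRegularity hA hν hT hcl hLH hdec⟩

/-! ## Equivalence: the route is a lossless reformulation of Clay (A) -/

/-- **`NavierStokesRegularity ↔ L3CascadeJaw ∧ SupercriticalSerrinL3`.**  Sufficiency is the route's
landed assembly (`l3TimeExponentPincer_assembly_proof` fed with the proved local-theory support
`noBlowupToClay_item`); necessity is the two on-path lemmas above. [folklore] -/
theorem navierStokesRegularity_iff_pincer :
    _root_.NavierStokesRegularity ↔ L3CascadeJaw ∧ SupercriticalSerrinL3 :=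
  ⟨fun hA => ⟨l3CascadeJaw_of_navierStokesRegularity hA, supercriticalSerrinL3_of_navierStokesRegularity hA⟩,
    fun h => l3TimeExponentPincer_assembly_proof h.1 h.2 noBlowupToClay_item⟩

/-- Given the residual, **the parent crux IS the summit**: `L3CascadeJaw ↔ NavierStokesRegularity`.
[folklore] -/
theorem l3CascadeJaw_iff_navierStokesRegularity (h₂ : SupercriticalSerrinL3) :
    L3CascadeJaw ↔ _root_.NavierStokesRegularity :=
  ⟨fun h₁ => navierStokesRegularity_iff_pincer.2 ⟨h₁, h₂⟩, l3CascadeJaw_of_navierStokesRegularity⟩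

/-- Given the parent crux, **the residual IS the summit**: `SupercriticalSerrinL3 ↔ NavierStokesRegularity`.
[folklore] -/
theorem supercriticalSerrinL3_iff_navierStokesRegularity (h₁ : L3CascadeJaw) :
    SupercriticalSerrinL3 ↔ _root_.NavierStokesRegularity :=
  ⟨fun h₂ => navierStokesRegularity_iff_pincer.2 ⟨h₁, h₂⟩, supercriticalSerrinL3_of_navierStokesRegularity⟩

/-- **The split form**: `NavierStokesRegularity ↔ EffSatBlowup ∧ SupercriticalSerrinL3` (the child crux
and the residual; `EffSatBlowup ⇒ L3CascadeJaw` is the landed glue `l3CascadeJaw_of_effSatBlowup`).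
[folklore] -/
theorem navierStokesRegularity_iff_effSat_and_residual :
    _root_.NavierStokesRegularity ↔ EffSatBlowup ∧ SupercriticalSerrinL3 :=
  ⟨fun hA => ⟨effSatBlowup_of_navierStokesRegularity hA, supercriticalSerrinL3_of_navierStokesRegularity hA⟩,
    fun h => navierStokesRegularity_iff_pincer.2
      ⟨L3TimeExponentPincerSmoothBranch.l3CascadeJaw_of_effSatBlowup h.1, h.2⟩⟩

/-! ## Kill value: refuting a crux proves Clay (C) -/

/-- `¬ L3CascadeJaw → ¬ NavierStokesRegularity` (contrapositive of necessity). [folklore] -/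
theorem not_navierStokesRegularity_of_not_l3CascadeJaw (h : ¬ L3CascadeJaw) :
    ¬ _root_.NavierStokesRegularity :=
  fun hA => h (l3CascadeJaw_of_navierStokesRegularity hA)

/-- **Refuting the parent crux proves Fefferman's (C).**  `¬ L3CascadeJaw` refutes Clay (A), and the
landed dichotomy `navierStokesRegularity_or_breakdownR3` ((A) ∨ (C), by the `ν`-normalisation) turns
that into the breakdown statement (C) on `ℝ³` — a summit-closing outcome on the negative side (board rule
D-0052). [cite: FeffermanClay2006, (A) (C)] -/
theorem navierStokesBreakdownR3_of_not_l3CascadeJaw (h : ¬ L3CascadeJaw) :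
    Summit.NavierStokesRegularity.NavierStokesRegularity.NavierStokesBreakdownR3 :=
  (navierStokesRegularity_or_breakdownR3).resolve_left (not_navierStokesRegularity_of_not_l3CascadeJaw h)

/-- **Refuting the child crux proves (C)** likewise. [cite: FeffermanClay2006, (A) (C)] -/
theorem navierStokesBreakdownR3_of_not_effSatBlowup (h : ¬ EffSatBlowup) :
    Summit.NavierStokesRegularity.NavierStokesRegularity.NavierStokesBreakdownR3 :=
  (navierStokesRegularity_or_breakdownR3).resolve_left fun hA => h (effSatBlowup_of_navierStokesRegularity hA)

/-- **Refuting the residual proves (C)** likewise (e.g. exhibiting a frame blow-up with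
`∫ ‖u‖₃^p < ∞` for every `p < 5`, such as a Type-I blow-up). [cite: FeffermanClay2006, (A) (C)] -/
theorem navierStokesBreakdownR3_of_not_supercriticalSerrinL3 (h : ¬ SupercriticalSerrinL3) :
    Summit.NavierStokesRegularity.NavierStokesRegularity.NavierStokesBreakdownR3 :=
  (navierStokesRegularity_or_breakdownR3).resolve_left
    fun hA => h (supercriticalSerrinL3_of_navierStokesRegularity hA)

end Summit.NavierStokesRegularity.NavierStokesRegularity.Theorems.L3TimeExponentPincerRouteEquivalence

end
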